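import Mathlib
import Summits.PneNP.PneNP.Theses.AeaCutRectangles
import Summits.PneNP.PneNP.Theorems.AeaCutRectanglesDutyRectangles
import Summits.PneNP.PneNP.Theorems.AeaCutRectanglesCriticalSupport

/-!
# Crux `FoolingMeasure` (stmt-PneNP-19727) / kill path `NoFoolingMeasure` (stmt-PneNP-19729) — p4 g16:
# SEAM FLEXIBILITY — the partition branch of the half-type floors is void on seam-critical supports

Lens «barrier inversion, typed just outside the class», applied at crux level, KILL side; the line after g15.
Restricted-model bookkeeping for the rectangle method; nothing here bears on P vs NP.

WHERE g15 LEFT IT.  `HalfTypeFloor.lean` (P4g15) typed the MASTER HALF FLOOR: X1 dies if every bisection-robust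
4-edge-critical `F` has a near-half cut `B`, a sub-core `R ⊆ B` on which every proper 3-colouring of `F[B]` induces
ONE partition (`CoreRigidInside B R F c₀`), and a floppy remainder `F[B] ⊆ F[R] ∪ β` that is small or listed.  Its two
pure branches are the LIST branch (`R = ∅`: few half-types) and the PARTITION branch (`β` small: a forced partition
captures almost all of Bob's half).  g15 §9 (K3) asked whether seam / subgroup-circulant designs have large forced
cores `R`.

THIS FILE answers (K3) for the one living construct species — seam-critical supports, i.e. the normal cycle systems
of `Ideas/normal-cycle-systems.md` — with theorems, and isolates what is left.

§1 (general, any edge-critical `F`, any cut `B`).  DEFECT COLOURINGS POPULATE BOB'S PROPER SET: for every edge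
`e ∈ F` leaving `B` there is a colouring proper on all of `F ∖ {e} ⊇ F[B]` and monochromatic on `e`
(`defect_colouring_bobProper`); and SUB-NAMING IS USELESS: `aliceSide B F ∪ β` is 3-colourable for every proper
subset `β ⊊ F[B]` (`aliceSide_union_colorable_of_ssubset`) — in the superset language Bob must name `F[B]` exactly.

§2 (general).  THE PARTITION BRANCH MEASURES FORCED PAIRS ONLY: if `F[B]` is core-rigid on `R` and two vertices of
`R` are SEPARABLE (some proper colouring of `F[B]` distinguishes them) they lie in different `c₀`-classes; if they are
also MERGEABLE they cannot both lie in `R` (`CoreRigidInside.not_both`).  Hence pairwise-separable `R` has `≤ 3`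
vertices (`CoreRigidInside.card_le_three`), pairwise-flexible `R` has `≤ 1` (`card_le_one`), and then the floppy
set is all of `F[B]` up to `≤ 6` edges (`card_bobSide_le_of_separable`).

§3 (normal cycle systems; vocabulary restated verbatim from `NormalCycleSystems.lean`, which is a crux workfile and
not importable).  Every seam colouring whose seam edge is not inside `B` is proper on Bob's half (`seam_bobProper`);
the SEAM VERDICT formula (`seam_verdict`): the seam based at `x` merges `u, w` iff `d ≡ 0` (seam behind `w` before
`u`) resp. `d ≡ 1` (seam behind `u` before `w`), `d` = the ruler distance from `w` to `u` (mod 3) — so seams on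
opposite sides give OPPOSITE verdicts unless `d ≡ 2`, when every seam separates (`flexible_of_opposite_seams`,
`separable_of_seam`).  Consequences: two run-STARTS (or two run-ENDS) of a common ruler inside `B` are always
separable and, unless `d ≡ 2`, also mergeable (`runStart_pair_separable/mergeable`, `runEnd_pair_…`); so a forced
core meets the run-starts and the run-ends of each ruler in `≤ 3` vertices (`card_core_inter_runStarts_le`,
`card_core_inter_runEnds_le`), whence `|R ∩ B| ≤ |B°| + 6t` with `B°` the all-ruler interior of `B`
(`core_card_le`), `|F[R ∩ B]| ≤ t·|R ∩ B|` (`card_bobSide_le`), and at every cut the partition branch certifies at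
most `e(S[B]) ≤ |β| + t(|B°| + 6t)` (`mixed_at_cut_le`): against normal systems the mixed / master floors of g15 are
the SPARSE-HALF floor up to the interior correction `t|B°|` — the same `|B°|` that the construct side's support
clause (card v7) already carries.  The finer statement (forced classes are common runs of ALL rulers; memo §2 (P))
uses `seam_verdict` with explicit seams.

§4 (g16 line B, reply to census r2s1g23 BN-g23-8 «parity tax»).  ONE-SIDED VERTICES: `B` is independent in Alice's side,
so vertices seeing one colour outside `B` recolour freely (`recolour_aliceProper`, `card_recolour_family`: a
`2^|W|`-subcube of Alice-proper colourings, pairwise distinct on `B`); under an internal seam of a normal system the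
BEFORE/AFTER LAW (`seamColour_after`, `seamColour_before`, `seamColour_pred_of_ne`, `normal_pred_val`) makes every
vertex preceding its outside neighbours one-sided (`oneSided_family`), e.g. the vertex right after the seam when it
is a ruler-middle (`middle_oneSided`): Alice-rigidity «EXT = seam words» fails at every cut with a run of length
`≥ 3`, and every word-level separator (parity, mod-3 phase, hash) is void on cycle systems (memo §10).
§5 CONJUGATE HYBRIDS ARE LIGHT (`conjugate_hybrid_proper`, `seam_conjugate_hybrid_colorable`; two-species form
`cross_hybrid_colorable_of_shared_word`: a shared internal/external word makes `S_A ∪ S'[B]` light): a member glued to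
its class-size-matched relabelling is 3-colourable — relabelling-closed member classes are never light-free.
§6 PHASE INCREMENT LAW (`seamColour_succ_add_one`, `phase_seam_succ`, `phase_triple`): the exact mod-3 separator
of internal from external seam words on triple cuts (void as a rectangle by §4).

Memo: `Cruxes/FoolingMeasure/BarrierNotesP4g16.md`.
-/

set_option linter.dupNamespace false

namespace Summit.PneNP.PneNP.Cruxes.FoolingMeasure.P4g16

open Finset
open Fin.CommRing
open Summit.PneNP.PneNP.Theorems.AeaCutRectanglesDutyRectangles
open Summit.PneNP.PneNP.Theorems.AeaCutRectanglesCriticalSupport (IsEdgeCritical)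

/-- 3-colourability of the graph spanned by an edge set over `Fin n` (as in the route file). -/
abbrev Col3 {n : ℕ} (G : Finset (Sym2 (Fin n))) : Prop :=
  (SimpleGraph.fromEdgeSet (G : Set (Sym2 (Fin n)))).Colorable 3

section General

variable {n : ℕ}

/-! ### §0 Vocabulary restated verbatim from `HalfTypeFloor.lean` (P4g15) -/

/-- The colourings inducing on `B` the same partition as `c₀`. [g15] -/
def samePartition (B : Finset (Fin n)) (c₀ : Fin n → Fin 3) : Set (Fin n → Fin 3) :=
  {c | ∀ x ∈ B, ∀ y ∈ B, c x = c y ↔ c₀ x = c₀ y}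

/-- `F[B]` is CORE-RIGID on the sub-core `R` (witness `c₀`): `c₀` is proper on the edges of `F` inside `R`, and every
colouring proper on the edges of `F` inside `B` induces `c₀`'s partition on `R`. [g15] -/
def CoreRigidInside (B R : Finset (Fin n)) (F : Finset (Sym2 (Fin n))) (c₀ : Fin n → Fin 3) : Prop :=
  c₀ ∉ killSet (bobSide R F) ∧ ∀ c : Fin n → Fin 3, c ∉ killSet (bobSide B F) → c ∈ samePartition R c₀

/-- A BISECTION-ROBUST 4-edge-critical edge set over `Fin n` [g13]: edge-critical, and every vertex set of size `≥ n/2`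
spans MORE than `n/2` of its edges. -/
def BisectionRobustCritical (F : Finset (Sym2 (Fin n))) : Prop :=
  IsEdgeCritical F ∧ ∀ S : Finset (Fin n), n ≤ 2 * S.card → n < 2 * (bobSide S F).card

/-! ### §1 Defect colourings populate Bob's proper set; sub-naming is useless -/

/-- Bob's half over `B` misses every edge leaving `B`. -/
theorem bobSide_subset_erase {B : Finset (Fin n)} {F : Finset (Sym2 (Fin n))} {e : Sym2 (Fin n)}
    (heB : ¬ ∀ v ∈ e, v ∈ B) : bobSide B F ⊆ F.erase e := by
  intro f hf
  obtain ⟨hfF, hfin⟩ := mem_bobSide.1 hf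
  refine Finset.mem_erase.2 ⟨?_, hfF⟩
  rintro rfl
  exact heB hfin

/-- DEFECT COLOURINGS: for edge-critical `F` and `e ∈ F`, some colouring is proper on every other edge of `F` and
monochromatic on `e` (criticality, read through the colourability bridge). -/
theorem exists_defect_colouring {F : Finset (Sym2 (Fin n))} (hF : IsEdgeCritical F) {e : Sym2 (Fin n)}
    (he : e ∈ F) : ∃ c : Fin n → Fin 3, c ∉ killSet (F.erase e) ∧ (e.map c).IsDiag := by
  obtain ⟨c, hc⟩ := (colorable_iff_exists_not_mem_killSet _).1 (hF.2.2 e he)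
  refine ⟨c, hc, ?_⟩
  by_contra hm
  obtain ⟨f, hf, hfd, hfm⟩ := (not_colorable_iff_forall_mem_killSet F).1 hF.2.1 c
  by_cases hfe : f = e
  · exact hm (hfe ▸ hfm)
  · exact hc ⟨f, Finset.mem_erase.2 ⟨hfe, hf⟩, hfd, hfm⟩

/-- **Defect colourings populate Bob's proper set.**  For edge-critical `F` and an edge `e ∈ F` LEAVING `B`, the
defect colouring of `e` is proper on Bob's half `F[B]`, monochromatic on `e`, hence kills Alice's side: it is a point
of `PROP(F[B]) ∖ EXT(F_A)`.  (For `e` inside `B` the same colouring is proper on Alice's side and improper on `F[B]`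
exactly at `e`.)  So `PROP(F[B])` contains one witness per edge leaving `B` — the raw material of §§2–3. -/
theorem defect_colouring_bobProper {B : Finset (Fin n)} {F : Finset (Sym2 (Fin n))} (hF : IsEdgeCritical F)
    {e : Sym2 (Fin n)} (he : e ∈ F) (heB : ¬ ∀ v ∈ e, v ∈ B) :
    ∃ c : Fin n → Fin 3, c ∉ killSet (bobSide B F) ∧ (e.map c).IsDiag ∧ c ∈ killSet (aliceSide B F) := by
  obtain ⟨c, hc, hm⟩ := exists_defect_colouring hF he
  refine ⟨c, fun h => hc (killSet_mono (bobSide_subset_erase heB) h), hm, ?_⟩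
  have heB' : ∃ v ∈ e, v ∉ B := by
    by_contra h
    push Not at h
    exact heB h
  exact ⟨e, mem_aliceSide.2 ⟨he, heB'⟩, hF.1 e he, hm⟩

/-- The companion for an edge INSIDE `B`: its defect colouring is proper on Alice's side (and on `F[B] ∖ {e}`). -/
theorem defect_colouring_aliceProper {B : Finset (Fin n)} {F : Finset (Sym2 (Fin n))} (hF : IsEdgeCritical F)
    {e : Sym2 (Fin n)} (he : e ∈ F) (heB : ∀ v ∈ e, v ∈ B) :
    ∃ c : Fin n → Fin 3, c ∉ killSet (aliceSide B F) ∧ (e.map c).IsDiag ∧ c ∈ killSet (bobSide B F) := by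
  obtain ⟨c, hc, hm⟩ := exists_defect_colouring hF he
  refine ⟨c, fun h => hc (killSet_mono (fun f hf => ?_) h), hm, ⟨e, mem_bobSide.2 ⟨he, heB⟩, hF.1 e he, hm⟩⟩
  obtain ⟨hfF, v, hv, hvB⟩ := mem_aliceSide.1 hf
  refine Finset.mem_erase.2 ⟨?_, hfF⟩
  rintro rfl
  exact hvB (heB v hv)

/-- **Sub-naming is useless** (superset language): for edge-critical `F`, Alice's side together with a PROPER subset
`β ⊊ F[B]` of Bob's half is 3-colourable — a Bob-set `{G : G[B] ⊇ β}` is legal against `F`'s Alice-fibre only for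
`β = F[B]` exactly (card v7.1 uses the `=` case; this is the converse direction). -/
theorem aliceSide_union_colorable_of_ssubset {B : Finset (Fin n)} {F β : Finset (Sym2 (Fin n))}
    (hF : IsEdgeCritical F) (hβ : β ⊂ bobSide B F) : Col3 (aliceSide B F ∪ β) := by
  refine hF.colorable_of_ssubset (Finset.ssubset_iff_subset_ne.2 ⟨?_, fun hEq => ?_⟩)
  · intro f hf
    rcases Finset.mem_union.1 hf with hf | hf
    · exact (mem_aliceSide.1 hf).1
    · exact (mem_bobSide.1 (hβ.1 hf)).1
  · obtain ⟨e, heB, heβ⟩ := Finset.exists_of_ssubset hβ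
    have heF : e ∈ aliceSide B F ∪ β := by rw [hEq]; exact (mem_bobSide.1 heB).1
    rcases Finset.mem_union.1 heF with h | h
    · obtain ⟨-, v, hv, hvB⟩ := mem_aliceSide.1 h
      exact hvB ((mem_bobSide.1 heB).2 v hv)
    · exact heβ h

/-! ### §2 The partition branch measures forced pairs only -/

/-- `u, w` are SEPARABLE inside `B`: some colouring proper on `F[B]` gives them different colours. -/
def Separable (B : Finset (Fin n)) (F : Finset (Sym2 (Fin n))) (u w : Fin n) : Prop :=
  ∃ c : Fin n → Fin 3, c ∉ killSet (bobSide B F) ∧ c u ≠ c w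

/-- `u, w` are MERGEABLE inside `B`: some colouring proper on `F[B]` gives them the same colour. -/
def Mergeable (B : Finset (Fin n)) (F : Finset (Sym2 (Fin n))) (u w : Fin n) : Prop :=
  ∃ c : Fin n → Fin 3, c ∉ killSet (bobSide B F) ∧ c u = c w

theorem CoreRigidInside.ne_of_separable {B R : Finset (Fin n)} {F : Finset (Sym2 (Fin n))} {c₀ : Fin n → Fin 3}
    (h : CoreRigidInside B R F c₀) {u w : Fin n} (hu : u ∈ R) (hw : w ∈ R) (hs : Separable B F u w) :
    c₀ u ≠ c₀ w := by
  obtain ⟨c, hc, hne⟩ := hs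
  exact fun heq => hne ((h.2 c hc u hu w hw).2 heq)

theorem CoreRigidInside.eq_of_mergeable {B R : Finset (Fin n)} {F : Finset (Sym2 (Fin n))} {c₀ : Fin n → Fin 3}
    (h : CoreRigidInside B R F c₀) {u w : Fin n} (hu : u ∈ R) (hw : w ∈ R) (hm : Mergeable B F u w) :
    c₀ u = c₀ w := by
  obtain ⟨c, hc, heq⟩ := hm
  exact (h.2 c hc u hu w hw).1 heq

/-- A pair that is both separable and mergeable inside `B` cannot lie in a forced core. -/
theorem CoreRigidInside.not_both {B R : Finset (Fin n)} {F : Finset (Sym2 (Fin n))} {c₀ : Fin n → Fin 3}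
    (h : CoreRigidInside B R F c₀) {u w : Fin n} (hu : u ∈ R) (hw : w ∈ R) (hs : Separable B F u w)
    (hm : Mergeable B F u w) : False :=
  h.ne_of_separable hu hw hs (h.eq_of_mergeable hu hw hm)

/-- **Pairwise separable forced cores have at most three vertices** (`c₀` is injective on them). -/
theorem CoreRigidInside.card_le_three {B R : Finset (Fin n)} {F : Finset (Sym2 (Fin n))} {c₀ : Fin n → Fin 3}
    (h : CoreRigidInside B R F c₀) (hsep : ∀ u ∈ R, ∀ w ∈ R, u ≠ w → Separable B F u w) : R.card ≤ 3 := by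
  have hinj : Set.InjOn c₀ R := fun u hu w hw heq => by
    by_contra hne
    exact h.ne_of_separable hu hw (hsep u hu w hw hne) heq
  calc R.card = (R.image c₀).card := (Finset.card_image_of_injOn hinj).symm
    _ ≤ (Finset.univ : Finset (Fin 3)).card := Finset.card_le_card (Finset.subset_univ _)
    _ = 3 := by simp

/-- **Pairwise flexible forced cores are trivial.** -/
theorem CoreRigidInside.card_le_one {B R : Finset (Fin n)} {F : Finset (Sym2 (Fin n))} {c₀ : Fin n → Fin 3}
    (h : CoreRigidInside B R F c₀)
    (hflex : ∀ u ∈ R, ∀ w ∈ R, u ≠ w → Separable B F u w ∧ Mergeable B F u w) : R.card ≤ 1 := by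
  rw [Finset.card_le_one]
  intro u hu w hw
  by_contra hne
  obtain ⟨hs, hm⟩ := hflex u hu w hw hne
  exact h.not_both hu hw hs hm

/-- Core-rigidity and the sandwich survive passing to `R ∩ B` (edges inside `B` and inside `R` are inside `R ∩ B`). -/
theorem CoreRigidInside.inter {B R : Finset (Fin n)} {F : Finset (Sym2 (Fin n))} {c₀ : Fin n → Fin 3}
    (h : CoreRigidInside B R F c₀) : CoreRigidInside B (R ∩ B) F c₀ := by
  refine ⟨fun hk => h.1 (killSet_mono (fun e he => ?_) hk), fun c hc x hx y hy => ?_⟩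
  · obtain ⟨heF, hin⟩ := mem_bobSide.1 he
    exact mem_bobSide.2 ⟨heF, fun v hv => (Finset.mem_inter.1 (hin v hv)).1⟩
  · exact h.2 c hc x (Finset.mem_inter.1 hx).1 y (Finset.mem_inter.1 hy).1

theorem sandwich_inter {B R : Finset (Fin n)} {F β : Finset (Sym2 (Fin n))}
    (hcov : bobSide B F ⊆ bobSide R F ∪ β) : bobSide B F ⊆ bobSide (R ∩ B) F ∪ β := by
  intro e he
  rcases Finset.mem_union.1 (hcov he) with h | h
  · refine Finset.mem_union.2 (Or.inl ?_)
    obtain ⟨heF, hinR⟩ := mem_bobSide.1 h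
    obtain ⟨-, hinB⟩ := mem_bobSide.1 he
    exact mem_bobSide.2 ⟨heF, fun v hv => Finset.mem_inter.2 ⟨hinR v hv, hinB v hv⟩⟩
  · exact Finset.mem_union.2 (Or.inr h)

/-- Bob's half over `R` lies in the symmetric square of `R`. -/
theorem bobSide_subset_sym2 (R : Finset (Fin n)) (F : Finset (Sym2 (Fin n))) : bobSide R F ⊆ R.sym2 := by
  intro e he
  exact Finset.mem_sym2_iff.2 (mem_bobSide.1 he).2

/-- **The partition branch certifies nothing beyond `6` edges on pairwise-separable halves**: if every pair of `R ∩ B`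
is separable inside `B`, a sandwich `F[B] ⊆ F[R] ∪ β` forces `|F[B]| ≤ |β| + 6`. -/
theorem card_bobSide_le_of_separable {B R : Finset (Fin n)} {F β : Finset (Sym2 (Fin n))} {c₀ : Fin n → Fin 3}
    (h : CoreRigidInside B R F c₀) (hsep : ∀ u ∈ R ∩ B, ∀ w ∈ R ∩ B, u ≠ w → Separable B F u w)
    (hcov : bobSide B F ⊆ bobSide R F ∪ β) : (bobSide B F).card ≤ β.card + 6 := by
  have h3 : (R ∩ B).card ≤ 3 := h.inter.card_le_three hsep
  have hsym : (bobSide (R ∩ B) F).card ≤ 6 := by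
    calc (bobSide (R ∩ B) F).card ≤ (R ∩ B).sym2.card := Finset.card_le_card (bobSide_subset_sym2 _ _)
      _ = ((R ∩ B).card + 1).choose 2 := Finset.card_sym2 _
      _ ≤ (3 + 1).choose 2 := Nat.choose_le_choose 2 (by omega)
      _ = 6 := by decide
  calc (bobSide B F).card ≤ (bobSide (R ∩ B) F ∪ β).card := Finset.card_le_card (sandwich_inter hcov)
    _ ≤ (bobSide (R ∩ B) F).card + β.card := Finset.card_union_le _ _
    _ ≤ β.card + 6 := by omega

end General

/-! ### §3 Normal cycle systems: seams make every run-boundary pair flexible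

Vocabulary restated verbatim from `Cruxes/FoolingMeasure/NormalCycleSystems.lean` (namespace `…IdeasR2g3`;
crux workfiles are not importable): `CycleSystem`, `succ`, `edges`, `Normal`, `seamColour`, `seam_proper`. -/

/-- `t` rulers of `Fin (3q+1)`: `pos k v` is the index of `v` along cycle `k`. [IdeasR2g3] -/
structure CycleSystem (q t : ℕ) where
  pos : Fin t → Equiv.Perm (Fin (3 * q + 1))

namespace CycleSystem

variable {q t : ℕ} (S : CycleSystem q t)

/-- successor of `v` along cycle `k`. [IdeasR2g3] -/
def succ (k : Fin t) (v : Fin (3 * q + 1)) : Fin (3 * q + 1) := (S.pos k).symm (S.pos k v + 1)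

/-- predecessor of `v` along cycle `k`. -/
def pred (k : Fin t) (v : Fin (3 * q + 1)) : Fin (3 * q + 1) := (S.pos k).symm (S.pos k v - 1)

/-- the graph of the system: the union of its `t` Hamiltonian cycles, as an edge set. [IdeasR2g3] -/
def edges : Finset (Sym2 (Fin (3 * q + 1))) :=
  (Finset.univ : Finset (Fin t × Fin (3 * q + 1))).image fun p => s(p.2, S.succ p.1 p.2)

/-- NORMALITY ("jump ≡ 2 mod 3"). [IdeasR2g3] -/
def Normal : Prop :=
  ∀ i k : Fin t, i ≠ k → ∀ v : Fin (3 * q + 1), (S.pos i (S.succ k v) - S.pos i v).val % 3 = 2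

theorem pos_succ (k : Fin t) (v : Fin (3 * q + 1)) : S.pos k (S.succ k v) = S.pos k v + 1 := by
  simp [succ]

theorem pos_pred (k : Fin t) (v : Fin (3 * q + 1)) : S.pos k (S.pred k v) = S.pos k v - 1 := by
  simp [pred]

theorem succ_pred (k : Fin t) (v : Fin (3 * q + 1)) : S.succ k (S.pred k v) = v := by
  simp [succ, pred]

theorem pred_succ (k : Fin t) (v : Fin (3 * q + 1)) : S.pred k (S.succ k v) = v := by
  simp [succ, pred]

theorem seam_mem_edges (k : Fin t) (v : Fin (3 * q + 1)) : s(v, S.succ k v) ∈ S.edges :=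
  Finset.mem_image.2 ⟨(k, v), Finset.mem_univ _, rfl⟩

/-- the ruler-`k` RUN-STARTS of `B`: vertices of `B` entered from outside `B` along cycle `k`. -/
def runStarts (k : Fin t) (B : Finset (Fin (3 * q + 1))) : Finset (Fin (3 * q + 1)) :=
  B.filter fun w => S.pred k w ∉ B

/-- the ruler-`k` RUN-ENDS of `B`: vertices of `B` left towards outside `B` along cycle `k`. -/
def runEnds (k : Fin t) (B : Finset (Fin (3 * q + 1))) : Finset (Fin (3 * q + 1)) :=
  B.filter fun w => S.succ k w ∉ B

/-- the all-ruler INTERIOR `B°` of `B`: vertices of `B` all of whose `2t` cycle-neighbours lie in `B`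
(the construct side's `B°`, card v7). -/
def interior (B : Finset (Fin (3 * q + 1))) : Finset (Fin (3 * q + 1)) :=
  B.filter fun w => ∀ k : Fin t, S.pred k w ∈ B ∧ S.succ k w ∈ B

/-- the vertex `m` steps behind `w` along ruler `k`. -/
def back (k : Fin t) (w : Fin (3 * q + 1)) (m : ℕ) : Fin (3 * q + 1) :=
  (S.pos k).symm (S.pos k w - (m : Fin (3 * q + 1)))

theorem pos_back (k : Fin t) (w : Fin (3 * q + 1)) (m : ℕ) :
    S.pos k (S.back k w m) = S.pos k w - (m : Fin (3 * q + 1)) := by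
  simp [back]

theorem back_zero (k : Fin t) (w : Fin (3 * q + 1)) : S.back k w 0 = w := by
  simp [back]

theorem back_succ (k : Fin t) (w : Fin (3 * q + 1)) (m : ℕ) :
    S.back k w (m + 1) = S.pred k (S.back k w m) := by
  apply (S.pos k).injective
  rw [pos_pred, pos_back, pos_back]
  push_cast
  ring

/-- `u` lies BEHIND `w` in `w`'s ruler-`k` run inside `B`: walking backwards from `w` along cycle `k` one reaches
`u` without leaving `B`. -/
def Behind (k : Fin t) (B : Finset (Fin (3 * q + 1))) (w u : Fin (3 * q + 1)) : Prop :=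
  ∃ m : ℕ, (∀ j ≤ m, S.back k w j ∈ B) ∧ S.back k w m = u

/-- `u, w` lie in a COMMON RUN of ruler `k` inside `B` (a run = a maximal arc of cycle `k` inside `B`). -/
def SameRun (k : Fin t) (B : Finset (Fin (3 * q + 1))) (u w : Fin (3 * q + 1)) : Prop :=
  S.Behind k B w u ∨ S.Behind k B u w

end CycleSystem

variable {q t : ℕ}

/-- the seam colouring of ruler `k` based at the edge `{v, succ_k v}`. [IdeasR2g3] -/
def seamColour (S : CycleSystem q t) (k : Fin t) (v w : Fin (3 * q + 1)) : Fin 3 :=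
  ⟨(S.pos k w - S.pos k v - 1).val % 3, Nat.mod_lt _ (by norm_num)⟩

/-- [IdeasR2g3, verbatim] the seam colouring is proper on every edge of a normal system except its seam edge. -/
theorem seam_proper (S : CycleSystem q t) (hq : 1 ≤ q) (hN : S.Normal) (k : Fin t) (v : Fin (3 * q + 1))
    (i : Fin t) (u : Fin (3 * q + 1)) (hu : ¬ (i = k ∧ u = v)) :
    seamColour S k v u ≠ seamColour S k v (S.succ i u) := by
  intro h
  have hval : (S.pos k u - S.pos k v - 1).val % 3 = (S.pos k (S.succ i u) - S.pos k v - 1).val % 3 :=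
    congrArg Fin.val h
  have hB : S.pos k (S.succ i u) - S.pos k v - 1 =
      (S.pos k u - S.pos k v - 1) + (S.pos k (S.succ i u) - S.pos k u) := by ring
  rw [hB, Fin.val_add] at hval
  set A := S.pos k u - S.pos k v - 1 with hA
  set D := S.pos k (S.succ i u) - S.pos k u with hD
  have hAlt := A.isLt
  have hDlt := D.isLt
  by_cases hik : i = k
  · subst hik
    have hD1 : D = 1 := by rw [hD, S.pos_succ]; ring
    have huv : u ≠ v := fun h' => hu ⟨rfl, h'⟩
    have h1v : (1 : Fin (3 * q + 1)).val = 1 := by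
      rw [Fin.val_one']; exact Nat.mod_eq_of_lt (by omega)
    have hA3q : A.val ≠ 3 * q := by
      intro h3
      apply huv
      have hneg : A = -1 := by
        apply Fin.ext
        rw [h3, Fin.coe_neg_one]
      have hpos : S.pos i u = S.pos i v := by
        have := hneg
        rw [hA] at this
        linear_combination this
      exact (S.pos i).injective hpos
    have hA1 : A.val + 1 < 3 * q + 1 := by omega
    rw [hD1, h1v, Nat.mod_eq_of_lt hA1] at hval
    omega
  · have hD2 : D.val % 3 = 2 := hN k i (Ne.symm hik) u
    by_cases hlt : A.val + D.val < 3 * q + 1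
    · rw [Nat.mod_eq_of_lt hlt] at hval
      omega
    · have hmod : (A.val + D.val) % (3 * q + 1) = A.val + D.val - (3 * q + 1) := by
        rw [Nat.mod_eq_sub_mod (by omega)]
        exact Nat.mod_eq_of_lt (by omega)
      rw [hmod] at hval
      omega

/-- [IdeasR2g3] value of a difference in `Fin (3q+1)`, by cases on the wrap. -/
theorem val_sub_cases (a b : Fin (3 * q + 1)) :
    (a.val ≤ b.val ∧ (b - a).val = b.val - a.val) ∨ (b.val < a.val ∧ (b - a).val = 3 * q + 1 + b.val - a.val) := by
  by_cases h : a ≤ b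
  · exact Or.inl ⟨Fin.le_def.1 h, Fin.coe_sub_iff_le.2 h⟩
  · have hlt : b < a := lt_of_not_ge h
    exact Or.inr ⟨Fin.lt_def.1 hlt, Fin.coe_sub_iff_lt.2 hlt⟩

/-! #### New in g16 -/

/-- the seam colouring misses the killing set of the system minus its seam edge. -/
theorem seam_not_mem_killSet_erase (S : CycleSystem q t) (hq : 1 ≤ q) (hN : S.Normal) (k : Fin t)
    (v : Fin (3 * q + 1)) : seamColour S k v ∉ killSet (S.edges.erase s(v, S.succ k v)) := by
  rintro ⟨e, he, -, hm⟩
  obtain ⟨hne, hG⟩ := Finset.mem_erase.mp he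
  obtain ⟨⟨i, u⟩, -, huw⟩ := Finset.mem_image.mp hG
  have huw' : s(u, S.succ i u) = e := huw
  have key : ¬ (i = k ∧ u = v) := by
    rintro ⟨rfl, rfl⟩
    exact hne huw'.symm
  rw [← huw', map_mk_isDiag_iff] at hm
  exact seam_proper S hq hN k v i u key hm

/-- **Seams are proper on Bob's half** as soon as the seam edge is not inside `B`. -/
theorem seam_bobProper (S : CycleSystem q t) (hq : 1 ≤ q) (hN : S.Normal) (k : Fin t) (v : Fin (3 * q + 1))
    {B : Finset (Fin (3 * q + 1))} (hvB : ¬ (v ∈ B ∧ S.succ k v ∈ B)) :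
    seamColour S k v ∉ killSet (bobSide B S.edges) := by
  intro h
  apply seam_not_mem_killSet_erase S hq hN k v
  refine killSet_mono (fun f hf => ?_) h
  obtain ⟨hfE, hfin⟩ := mem_bobSide.1 hf
  refine Finset.mem_erase.2 ⟨?_, hfE⟩
  rintro rfl
  exact hvB ⟨hfin v (Sym2.mem_mk_left _ _), hfin _ (Sym2.mem_mk_right _ _)⟩

/-- **SEAM VERDICT.**  The seam based at `x` gives `u` and `w` the same colour iff: `w` is met no later than `u`
walking forward from `succ x` and the ruler distance `d` from `w` to `u` is `≡ 0 (mod 3)`, or `u` is met first and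
`d ≡ 1`.  (So every seam separates a pair with `d ≡ 2`, and seams on opposite sides of a pair with `d ≢ 2` give
opposite verdicts.) -/
theorem seam_verdict (S : CycleSystem q t) (k : Fin t) (x u w : Fin (3 * q + 1)) :
    seamColour S k x u = seamColour S k x w ↔
      (((S.pos k w - S.pos k x - 1).val ≤ (S.pos k u - S.pos k x - 1).val ∧ (S.pos k u - S.pos k w).val % 3 = 0) ∨
       ((S.pos k u - S.pos k x - 1).val < (S.pos k w - S.pos k x - 1).val ∧ (S.pos k u - S.pos k w).val % 3 = 1)) := by
  have hrel : S.pos k u - S.pos k w = (S.pos k u - S.pos k x - 1) - (S.pos k w - S.pos k x - 1) := by ring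
  rw [Fin.ext_iff]
  show (S.pos k u - S.pos k x - 1).val % 3 = (S.pos k w - S.pos k x - 1).val % 3 ↔ _
  rw [hrel]
  set A := S.pos k u - S.pos k x - 1
  set B := S.pos k w - S.pos k x - 1
  have hA := A.isLt
  have hB := B.isLt
  rcases val_sub_cases B A with ⟨h1, e1⟩ | ⟨h1, e1⟩ <;> rw [e1] <;> omega

/-- Every available seam SEPARATES a pair at ruler distance `≡ 2 (mod 3)`. -/
theorem separable_of_seam (S : CycleSystem q t) (hq : 1 ≤ q) (hN : S.Normal) (k : Fin t)
    {B : Finset (Fin (3 * q + 1))} {x u w : Fin (3 * q + 1)} (hx : ¬ (x ∈ B ∧ S.succ k x ∈ B))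
    (hd : (S.pos k u - S.pos k w).val % 3 = 2) : Separable B S.edges u w := by
  refine ⟨seamColour S k x, seam_bobProper S hq hN k x hx, fun h => ?_⟩
  rcases (seam_verdict S k x u w).1 h with ⟨-, h0⟩ | ⟨-, h1⟩ <;> omega

/-- **Opposite seams give opposite verdicts**: two available seams of ruler `k`, one behind `w` before `u` and one
behind `u` before `w`, make a pair with `d ≢ 2` both mergeable and separable inside `B`. -/
theorem flexible_of_opposite_seams (S : CycleSystem q t) (hq : 1 ≤ q) (hN : S.Normal) (k : Fin t)
    {B : Finset (Fin (3 * q + 1))} {x₁ x₂ u w : Fin (3 * q + 1)}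
    (hx₁ : ¬ (x₁ ∈ B ∧ S.succ k x₁ ∈ B)) (hx₂ : ¬ (x₂ ∈ B ∧ S.succ k x₂ ∈ B))
    (hside₁ : (S.pos k w - S.pos k x₁ - 1).val ≤ (S.pos k u - S.pos k x₁ - 1).val)
    (hside₂ : (S.pos k u - S.pos k x₂ - 1).val < (S.pos k w - S.pos k x₂ - 1).val)
    (hd : (S.pos k u - S.pos k w).val % 3 ≠ 2) : Separable B S.edges u w ∧ Mergeable B S.edges u w := by
  have hlt3 : (S.pos k u - S.pos k w).val % 3 < 3 := Nat.mod_lt _ (by norm_num)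
  by_cases h0 : (S.pos k u - S.pos k w).val % 3 = 0
  · refine ⟨⟨seamColour S k x₂, seam_bobProper S hq hN k x₂ hx₂, fun h => ?_⟩,
      ⟨seamColour S k x₁, seam_bobProper S hq hN k x₁ hx₁, (seam_verdict S k x₁ u w).2 (Or.inl ⟨hside₁, h0⟩)⟩⟩
    rcases (seam_verdict S k x₂ u w).1 h with ⟨h', -⟩ | ⟨-, h1⟩ <;> omega
  · have h1 : (S.pos k u - S.pos k w).val % 3 = 1 := by omega
    refine ⟨⟨seamColour S k x₁, seam_bobProper S hq hN k x₁ hx₁, fun h => ?_⟩,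
      ⟨seamColour S k x₂, seam_bobProper S hq hN k x₂ hx₂, (seam_verdict S k x₂ u w).2 (Or.inr ⟨hside₂, h1⟩)⟩⟩
    rcases (seam_verdict S k x₁ u w).1 h with ⟨-, h'⟩ | ⟨h', -⟩ <;> omega

/-- the two ruler distances between distinct vertices add up to `3q+1`. -/
theorem val_sub_add_val_sub (S : CycleSystem q t) (k : Fin t) {u w : Fin (3 * q + 1)} (huw : u ≠ w) :
    (S.pos k u - S.pos k w).val + (S.pos k w - S.pos k u).val = 3 * q + 1 := by
  have hne : (S.pos k u).val ≠ (S.pos k w).val := fun h => huw ((S.pos k).injective (Fin.ext h))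
  have ha := (S.pos k u).isLt
  have hb := (S.pos k w).isLt
  rcases val_sub_cases (S.pos k w) (S.pos k u) with ⟨h1, e1⟩ | ⟨h1, e1⟩ <;>
    rcases val_sub_cases (S.pos k u) (S.pos k w) with ⟨h2, e2⟩ | ⟨h2, e2⟩ <;> omega

/-- the seam just BEHIND `w` (edge `{pred w, w}`): colour(`y`) = distance from `w` to `y` (mod 3). -/
theorem seamColour_pred_val (S : CycleSystem q t) (k : Fin t) (w y : Fin (3 * q + 1)) :
    (seamColour S k (S.pred k w) y).val = (S.pos k y - S.pos k w).val % 3 := by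
  show (S.pos k y - S.pos k (S.pred k w) - 1).val % 3 = _
  rw [S.pos_pred]
  have : S.pos k y - (S.pos k w - 1) - 1 = S.pos k y - S.pos k w := by ring
  rw [this]

/-- the seam AT `w` (edge `{w, succ w}`): colour(`y`) = distance from `w` to `y`, minus one (mod 3), for `y ≠ w`. -/
theorem seamColour_self_val (S : CycleSystem q t) (hq : 1 ≤ q) (k : Fin t) {w y : Fin (3 * q + 1)} (hy : y ≠ w) :
    (seamColour S k w y).val = ((S.pos k y - S.pos k w).val - 1) % 3 := by
  show (S.pos k y - S.pos k w - 1).val % 3 = _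
  have h1v : (1 : Fin (3 * q + 1)).val = 1 := by
    rw [Fin.val_one']; exact Nat.mod_eq_of_lt (by omega)
  have hne : S.pos k y - S.pos k w ≠ 0 := by
    intro h
    exact hy ((S.pos k).injective (sub_eq_zero.1 h))
  have hpos : 1 ≤ (S.pos k y - S.pos k w).val := by
    rcases Nat.eq_zero_or_pos (S.pos k y - S.pos k w).val with h | h
    · exact absurd (Fin.ext h) hne
    · exact h
  rw [Fin.coe_sub_iff_le.2 (by
    change (1 : Fin (3 * q + 1)).val ≤ (S.pos k y - S.pos k w).val
    rw [h1v]; exact hpos), h1v]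

theorem seamColour_self_self (S : CycleSystem q t) (k : Fin t) (w : Fin (3 * q + 1)) :
    (seamColour S k w w).val = 0 := by
  show (S.pos k w - S.pos k w - 1).val % 3 = 0
  rw [sub_self, zero_sub, Fin.coe_neg_one]
  omega

/-- **Run-starts are pairwise separable**: two vertices of `B` both entered from outside along ruler `k`. -/
theorem runStart_pair_separable (S : CycleSystem q t) (hq : 1 ≤ q) (hN : S.Normal) (k : Fin t)
    {B : Finset (Fin (3 * q + 1))} {u w : Fin (3 * q + 1)} (huw : u ≠ w)
    (hpu : S.pred k u ∉ B) (hpw : S.pred k w ∉ B) : Separable B S.edges u w := by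
  have hsum := val_sub_add_val_sub S k huw
  have hau : seamColour S k (S.pred k u) ∉ killSet (bobSide B S.edges) :=
    seam_bobProper S hq hN k _ (fun h => hpu h.1)
  have haw : seamColour S k (S.pred k w) ∉ killSet (bobSide B S.edges) :=
    seam_bobProper S hq hN k _ (fun h => hpw h.1)
  by_cases h0 : (S.pos k u - S.pos k w).val % 3 = 0
  · -- the seam behind `u` separates
    refine ⟨_, hau, fun h => ?_⟩
    have := congrArg Fin.val h
    rw [seamColour_pred_val, seamColour_pred_val, sub_self, Fin.val_zero] at this
    omega
  · -- the seam behind `w` separates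
    refine ⟨_, haw, fun h => ?_⟩
    have := congrArg Fin.val h
    rw [seamColour_pred_val, seamColour_pred_val, sub_self, Fin.val_zero] at this
    omega

/-- **Run-starts at distance `≢ 2` are mergeable.** -/
theorem runStart_pair_mergeable (S : CycleSystem q t) (hq : 1 ≤ q) (hN : S.Normal) (k : Fin t)
    {B : Finset (Fin (3 * q + 1))} {u w : Fin (3 * q + 1)} (huw : u ≠ w)
    (hpu : S.pred k u ∉ B) (hpw : S.pred k w ∉ B) (hd : (S.pos k u - S.pos k w).val % 3 ≠ 2) :
    Mergeable B S.edges u w := by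
  have hsum := val_sub_add_val_sub S k huw
  have hlt3 : (S.pos k u - S.pos k w).val % 3 < 3 := Nat.mod_lt _ (by norm_num)
  by_cases h0 : (S.pos k u - S.pos k w).val % 3 = 0
  · -- the seam behind `w` merges
    refine ⟨_, seam_bobProper S hq hN k _ (fun h => hpw h.1), Fin.ext ?_⟩
    rw [seamColour_pred_val, seamColour_pred_val, sub_self, Fin.val_zero]
    omega
  · -- `d ≡ 1`: the seam behind `u` merges
    refine ⟨_, seam_bobProper S hq hN k _ (fun h => hpu h.1), Fin.ext ?_⟩
    rw [seamColour_pred_val, seamColour_pred_val, sub_self, Fin.val_zero]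
    omega

/-- **Run-ends are pairwise separable.** -/
theorem runEnd_pair_separable (S : CycleSystem q t) (hq : 1 ≤ q) (hN : S.Normal) (k : Fin t)
    {B : Finset (Fin (3 * q + 1))} {u w : Fin (3 * q + 1)} (huw : u ≠ w)
    (hsu : S.succ k u ∉ B) (hsw : S.succ k w ∉ B) : Separable B S.edges u w := by
  have hsum := val_sub_add_val_sub S k huw
  have hu1 := seamColour_self_val S hq k (Ne.symm huw)   -- seam at u, evaluated at w
  have hw1 := seamColour_self_val S hq k huw             -- seam at w, evaluated at u
  have hau : seamColour S k u ∉ killSet (bobSide B S.edges) := seam_bobProper S hq hN k _ (fun h => hsu h.2)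
  have haw : seamColour S k w ∉ killSet (bobSide B S.edges) := seam_bobProper S hq hN k _ (fun h => hsw h.2)
  have hzu := seamColour_self_self S k u
  have hzw := seamColour_self_self S k w
  by_cases h1 : (S.pos k u - S.pos k w).val % 3 = 1
  · -- the seam at `u` separates
    refine ⟨_, hau, fun h => ?_⟩
    have := congrArg Fin.val h
    omega
  · -- the seam at `w` separates
    refine ⟨_, haw, fun h => ?_⟩
    have := congrArg Fin.val h
    omega

/-- **Run-ends at distance `≢ 2` are mergeable.** -/
theorem runEnd_pair_mergeable (S : CycleSystem q t) (hq : 1 ≤ q) (hN : S.Normal) (k : Fin t)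
    {B : Finset (Fin (3 * q + 1))} {u w : Fin (3 * q + 1)} (huw : u ≠ w)
    (hsu : S.succ k u ∉ B) (hsw : S.succ k w ∉ B) (hd : (S.pos k u - S.pos k w).val % 3 ≠ 2) :
    Mergeable B S.edges u w := by
  have hsum := val_sub_add_val_sub S k huw
  have hlt3 : (S.pos k u - S.pos k w).val % 3 < 3 := Nat.mod_lt _ (by norm_num)
  have hu1 := seamColour_self_val S hq k (Ne.symm huw)
  have hw1 := seamColour_self_val S hq k huw
  have hzu := seamColour_self_self S k u
  have hzw := seamColour_self_self S k w
  by_cases h1 : (S.pos k u - S.pos k w).val % 3 = 1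
  · -- the seam at `w` merges
    exact ⟨_, seam_bobProper S hq hN k _ (fun h => hsw h.2), Fin.ext (by omega)⟩
  · -- `d ≡ 0`: the seam at `u` merges
    exact ⟨_, seam_bobProper S hq hN k _ (fun h => hsu h.2), Fin.ext (by omega)⟩

/-- **A forced core meets the run-starts of each ruler in at most three vertices.** -/
theorem card_core_inter_runStarts_le (S : CycleSystem q t) (hq : 1 ≤ q) (hN : S.Normal)
    {B R : Finset (Fin (3 * q + 1))} {c₀ : Fin (3 * q + 1) → Fin 3} (h : CoreRigidInside B R S.edges c₀)
    (k : Fin t) : (R ∩ S.runStarts k B).card ≤ 3 := by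
  have hinj : Set.InjOn c₀ (R ∩ S.runStarts k B : Finset _) := fun u hu w hw heq => by
    by_contra hne
    obtain ⟨huR, hu'⟩ := Finset.mem_inter.1 hu
    obtain ⟨hwR, hw'⟩ := Finset.mem_inter.1 hw
    obtain ⟨-, hpu⟩ := Finset.mem_filter.1 hu'
    obtain ⟨-, hpw⟩ := Finset.mem_filter.1 hw'
    exact h.ne_of_separable huR hwR (runStart_pair_separable S hq hN k hne hpu hpw) heq
  calc (R ∩ S.runStarts k B).card = ((R ∩ S.runStarts k B).image c₀).card :=
        (Finset.card_image_of_injOn hinj).symm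
    _ ≤ (Finset.univ : Finset (Fin 3)).card := Finset.card_le_card (Finset.subset_univ _)
    _ = 3 := by simp

/-- **… and the run-ends of each ruler in at most three vertices.** -/
theorem card_core_inter_runEnds_le (S : CycleSystem q t) (hq : 1 ≤ q) (hN : S.Normal)
    {B R : Finset (Fin (3 * q + 1))} {c₀ : Fin (3 * q + 1) → Fin 3} (h : CoreRigidInside B R S.edges c₀)
    (k : Fin t) : (R ∩ S.runEnds k B).card ≤ 3 := by
  have hinj : Set.InjOn c₀ (R ∩ S.runEnds k B : Finset _) := fun u hu w hw heq => by
    by_contra hne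
    obtain ⟨huR, hu'⟩ := Finset.mem_inter.1 hu
    obtain ⟨hwR, hw'⟩ := Finset.mem_inter.1 hw
    obtain ⟨-, hsu⟩ := Finset.mem_filter.1 hu'
    obtain ⟨-, hsw⟩ := Finset.mem_filter.1 hw'
    exact h.ne_of_separable huR hwR (runEnd_pair_separable S hq hN k hne hsu hsw) heq
  calc (R ∩ S.runEnds k B).card = ((R ∩ S.runEnds k B).image c₀).card :=
        (Finset.card_image_of_injOn hinj).symm
    _ ≤ (Finset.univ : Finset (Fin 3)).card := Finset.card_le_card (Finset.subset_univ _)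
    _ = 3 := by simp

/-- Run-boundary pairs at distance `≢ 2` cannot BOTH lie in a forced core. -/
theorem not_both_runStarts (S : CycleSystem q t) (hq : 1 ≤ q) (hN : S.Normal)
    {B R : Finset (Fin (3 * q + 1))} {c₀ : Fin (3 * q + 1) → Fin 3} (h : CoreRigidInside B R S.edges c₀)
    (k : Fin t) {u w : Fin (3 * q + 1)} (huw : u ≠ w) (hu : u ∈ R) (hw : w ∈ R)
    (hpu : S.pred k u ∉ B) (hpw : S.pred k w ∉ B) : (S.pos k u - S.pos k w).val % 3 = 2 := by
  by_contra hd
  exact h.not_both hu hw (runStart_pair_separable S hq hN k huw hpu hpw)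
    (runStart_pair_mergeable S hq hN k huw hpu hpw hd)

/-- **Forced cores live in the interior**: `|R ∩ B| ≤ |B°| + 6t`. -/
theorem core_card_le (S : CycleSystem q t) (hq : 1 ≤ q) (hN : S.Normal)
    {B R : Finset (Fin (3 * q + 1))} {c₀ : Fin (3 * q + 1) → Fin 3} (h : CoreRigidInside B R S.edges c₀) :
    (R ∩ B).card ≤ (S.interior B).card + 6 * t := by
  classical
  set R' := R ∩ B with hR'
  have h' : CoreRigidInside B R' S.edges c₀ := h.inter
  have hcover : R' ⊆ S.interior B ∪
      (Finset.univ : Finset (Fin t)).biUnion (fun k => (R' ∩ S.runStarts k B) ∪ (R' ∩ S.runEnds k B)) := by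
    intro w hw
    obtain ⟨hwR, hwB⟩ := Finset.mem_inter.1 hw
    by_cases hint : ∀ k : Fin t, S.pred k w ∈ B ∧ S.succ k w ∈ B
    · exact Finset.mem_union.2 (Or.inl (Finset.mem_filter.2 ⟨hwB, hint⟩))
    · push Not at hint
      obtain ⟨k, hk⟩ := hint
      refine Finset.mem_union.2 (Or.inr (Finset.mem_biUnion.2 ⟨k, Finset.mem_univ _, ?_⟩))
      by_cases hp : S.pred k w ∈ B
      · exact Finset.mem_union.2 (Or.inr (Finset.mem_inter.2 ⟨hw, Finset.mem_filter.2 ⟨hwB, hk hp⟩⟩))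
      · exact Finset.mem_union.2 (Or.inl (Finset.mem_inter.2 ⟨hw, Finset.mem_filter.2 ⟨hwB, hp⟩⟩))
  have hk : ∀ k : Fin t, ((R' ∩ S.runStarts k B) ∪ (R' ∩ S.runEnds k B)).card ≤ 6 := fun k =>
    (Finset.card_union_le _ _).trans
      (Nat.add_le_add (card_core_inter_runStarts_le S hq hN h' k) (card_core_inter_runEnds_le S hq hN h' k))
  calc R'.card ≤ (S.interior B ∪ (Finset.univ : Finset (Fin t)).biUnion
        (fun k => (R' ∩ S.runStarts k B) ∪ (R' ∩ S.runEnds k B))).card := Finset.card_le_card hcover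
    _ ≤ (S.interior B).card + ((Finset.univ : Finset (Fin t)).biUnion
        (fun k => (R' ∩ S.runStarts k B) ∪ (R' ∩ S.runEnds k B))).card := Finset.card_union_le _ _
    _ ≤ (S.interior B).card + ∑ k : Fin t, ((R' ∩ S.runStarts k B) ∪ (R' ∩ S.runEnds k B)).card := by
        gcongr; exact Finset.card_biUnion_le
    _ ≤ (S.interior B).card + ∑ _k : Fin t, 6 := by gcongr with k; exact hk k
    _ = (S.interior B).card + 6 * t := by simp [mul_comm]

/-- **Edges inside `R`**: at most `t·|R|` (each is `{pred_k w, w}` for some ruler `k` and `w ∈ R`). -/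
theorem card_bobSide_le (S : CycleSystem q t) (R : Finset (Fin (3 * q + 1))) :
    (bobSide R S.edges).card ≤ t * R.card := by
  classical
  have hsub : bobSide R S.edges ⊆
      ((Finset.univ : Finset (Fin t)) ×ˢ R).image (fun p => s(S.pred p.1 p.2, p.2)) := by
    intro e he
    obtain ⟨heE, hin⟩ := mem_bobSide.1 he
    obtain ⟨⟨k, v⟩, -, hkv⟩ := Finset.mem_image.1 heE
    have hkv' : s(v, S.succ k v) = e := hkv
    refine Finset.mem_image.2 ⟨(k, S.succ k v), Finset.mem_product.2 ⟨Finset.mem_univ _, ?_⟩, ?_⟩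
    · exact hin _ (hkv' ▸ Sym2.mem_mk_right _ _)
    · show s(S.pred k (S.succ k v), S.succ k v) = e
      rw [S.pred_succ, hkv']
  calc (bobSide R S.edges).card
      ≤ (((Finset.univ : Finset (Fin t)) ×ˢ R).image (fun p => s(S.pred p.1 p.2, p.2))).card :=
        Finset.card_le_card hsub
    _ ≤ ((Finset.univ : Finset (Fin t)) ×ˢ R).card := Finset.card_image_le
    _ = t * R.card := by simp

/-- **THE PARTITION BRANCH AT A CUT OF A NORMAL SYSTEM.**  For a normal cycle system, any cut `B`, any forced core
`(R, c₀)` and any sandwich `S[B] ⊆ S[R] ∪ β`: `e(S[B]) ≤ |β| + t·(|B°| + 6t)`.  So the mixed / master floors of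
`HalfTypeFloor.lean` certify against normal systems only halves that are SPARSE up to the interior correction —
the partition part contributes at most `t|B°| + 6t²` edges, at every cut. -/
theorem mixed_at_cut_le (S : CycleSystem q t) (hq : 1 ≤ q) (hN : S.Normal)
    {B R : Finset (Fin (3 * q + 1))} {c₀ : Fin (3 * q + 1) → Fin 3} {β : Finset (Sym2 (Fin (3 * q + 1)))}
    (h : CoreRigidInside B R S.edges c₀) (hcov : bobSide B S.edges ⊆ bobSide R S.edges ∪ β) :
    (bobSide B S.edges).card ≤ β.card + t * ((S.interior B).card + 6 * t) := by
  have h1 := core_card_le S hq hN h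
  have h2 := card_bobSide_le S (R ∩ B)
  calc (bobSide B S.edges).card ≤ (bobSide (R ∩ B) S.edges ∪ β).card :=
        Finset.card_le_card (sandwich_inter hcov)
    _ ≤ (bobSide (R ∩ B) S.edges).card + β.card := Finset.card_union_le _ _
    _ ≤ t * (R ∩ B).card + β.card := by omega
    _ ≤ t * ((S.interior B).card + 6 * t) + β.card := by gcongr
    _ = β.card + t * ((S.interior B).card + 6 * t) := by ring

/-! #### Forced classes are common runs of every ruler -/

theorem natCast_val {m : ℕ} (hm : m < 3 * q + 1) : ((m : ℕ) : Fin (3 * q + 1)).val = m := by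
  rw [Fin.val_natCast, Nat.mod_eq_of_lt hm]

/-- the RUN-START behind `w`: walking backwards from `w ∈ B` along ruler `k` one leaves `B` after `m ≥ 1` steps,
having stayed in `B` before (needs one vertex outside `B`). -/
theorem exists_exit (S : CycleSystem q t) (k : Fin t) {B : Finset (Fin (3 * q + 1))} {w z : Fin (3 * q + 1)}
    (hw : w ∈ B) (hz : z ∉ B) :
    ∃ m : ℕ, 1 ≤ m ∧ m < 3 * q + 1 ∧ S.back k w m ∉ B ∧ ∀ j < m, S.back k w j ∈ B := by
  classical
  have hbz : S.back k w (S.pos k w - S.pos k z).val = z := by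
    apply (S.pos k).injective
    rw [S.pos_back, Fin.cast_val_eq_self]
    ring
  have hex : ∃ m, S.back k w m ∉ B := ⟨_, by rwa [hbz]⟩
  refine ⟨Nat.find hex, ?_, ?_, Nat.find_spec hex, fun j hj => ?_⟩
  · rcases Nat.eq_zero_or_pos (Nat.find hex) with h0 | h0
    · exfalso
      have h := Nat.find_spec hex
      rw [h0, S.back_zero] at h
      exact h hw
    · exact h0
  · have hle : Nat.find hex ≤ (S.pos k w - S.pos k z).val := Nat.find_min' hex (by rwa [hbz])
    exact lt_of_le_of_lt hle (Fin.isLt _)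
  · have h := Nat.find_min hex hj
    simpa using h

/-- SIDE CONDITION from a run-start: seen from the exit seam `x = back m` behind `w`, a vertex `u` NOT in `w`'s run
behind `w` is met no earlier than `w`. -/
theorem side_of_exit (S : CycleSystem q t) (hq : 1 ≤ q) (k : Fin t) {B : Finset (Fin (3 * q + 1))}
    {w u : Fin (3 * q + 1)} {m : ℕ} (hm1 : 1 ≤ m) (hmn : m < 3 * q + 1) (hrun : ∀ j < m, S.back k w j ∈ B)
    (hnot : ¬ S.Behind k B w u) :
    (S.pos k w - S.pos k (S.back k w m) - 1).val ≤ (S.pos k u - S.pos k (S.back k w m) - 1).val := by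
  have h1v : (1 : Fin (3 * q + 1)).val = 1 := by
    rw [Fin.val_one']; exact Nat.mod_eq_of_lt (by omega)
  have hmv : ((m : ℕ) : Fin (3 * q + 1)).val = m := natCast_val hmn
  set D := S.pos k u - S.pos k w with hD
  have hX : S.pos k w - S.pos k (S.back k w m) - 1 = (m : Fin (3 * q + 1)) - 1 := by
    rw [S.pos_back]; ring
  have hY : S.pos k u - S.pos k (S.back k w m) - 1 = D + ((m : Fin (3 * q + 1)) - 1) := by
    rw [S.pos_back, hD]; ring
  have hM1 : ((m : Fin (3 * q + 1)) - 1).val = m - 1 := by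
    rw [Fin.coe_sub_iff_le.2 (by rw [Fin.le_def, h1v, hmv]; exact hm1), hmv, h1v]
  rw [hX, hY, Fin.val_add, hM1]
  have hDlt := D.isLt
  by_cases hwrap : D.val + (m - 1) < 3 * q + 1
  · rw [Nat.mod_eq_of_lt hwrap]; omega
  · exfalso
    -- then `u` IS in `w`'s run: `u = back j` with `j = 3q+1 - D.val`, `1 ≤ j < m`
    have hj1 : 1 ≤ 3 * q + 1 - D.val := by omega
    have hjm : 3 * q + 1 - D.val < m := by omega
    apply hnot
    refine ⟨3 * q + 1 - D.val, fun i hi => hrun i (lt_of_le_of_lt hi hjm), ?_⟩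
    apply (S.pos k).injective
    rw [S.pos_back]
    have hneg : (((3 * q + 1 - D.val : ℕ)) : Fin (3 * q + 1)) = -D := by
      apply Fin.ext
      rw [natCast_val (by omega), Fin.val_neg', Nat.mod_eq_of_lt (by omega)]
    rw [hneg, hD]
    ring

/-- an exit seam behind `w` separates every pair at distance `≡ 2`. -/
theorem separable_of_exit (S : CycleSystem q t) (hq : 1 ≤ q) (hN : S.Normal) (k : Fin t)
    {B : Finset (Fin (3 * q + 1))} {u w : Fin (3 * q + 1)} (hw : w ∈ B) (hB : ∃ z, z ∉ B)
    (hd : (S.pos k u - S.pos k w).val % 3 = 2) : Separable B S.edges u w := by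
  obtain ⟨z, hz⟩ := hB
  obtain ⟨m, -, -, hout, -⟩ := exists_exit S k hw hz
  exact separable_of_seam S hq hN k (fun hx => hout hx.1) hd

/-- **Pairs NOT in a common run are flexible** (`d ≢ 2`): the exit seams behind `w` and behind `u` are opposite. -/
theorem flexible_of_not_sameRun (S : CycleSystem q t) (hq : 1 ≤ q) (hN : S.Normal) (k : Fin t)
    {B : Finset (Fin (3 * q + 1))} {u w : Fin (3 * q + 1)} (hu : u ∈ B) (hw : w ∈ B) (huw : u ≠ w)
    (hB : ∃ z, z ∉ B) (hrun : ¬ S.SameRun k B u w) (hd : (S.pos k u - S.pos k w).val % 3 ≠ 2) :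
    Separable B S.edges u w ∧ Mergeable B S.edges u w := by
  obtain ⟨z, hz⟩ := hB
  obtain ⟨m₁, h1₁, hn₁, hout₁, hin₁⟩ := exists_exit S k hw hz
  obtain ⟨m₂, h1₂, hn₂, hout₂, hin₂⟩ := exists_exit S k hu hz
  have hside₁ := side_of_exit S hq k h1₁ hn₁ hin₁ (fun h => hrun (Or.inl h))
  have hside₂' := side_of_exit S hq k h1₂ hn₂ hin₂ (fun h => hrun (Or.inr h))
  have hside₂ : (S.pos k u - S.pos k (S.back k u m₂) - 1).val <
      (S.pos k w - S.pos k (S.back k u m₂) - 1).val := by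
    refine lt_of_le_of_ne hside₂' (fun heq => huw ?_)
    have h' : S.pos k u - S.pos k (S.back k u m₂) - 1 = S.pos k w - S.pos k (S.back k u m₂) - 1 := Fin.ext heq
    apply (S.pos k).injective
    linear_combination h'
  exact flexible_of_opposite_seams S hq hN k (fun hx => hout₁ hx.1) (fun hx => hout₂ hx.1) hside₁ hside₂ hd

/-- **FORCED CLASSES ARE COMMON RUNS.**  In a normal cycle system, two distinct vertices of `B` in the same class of
a forced core `(R, c₀)` over `B` lie in a common run of EVERY ruler inside `B` (as soon as `B ≠ V`).  With `≤ 3`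
classes this gives `|R ∩ B| ≤ 3ρ` and `e(S[B]) ≤ |β| + 3tρ` for any bound `ρ` on the size of a subset of `B` lying in
a common run of all rulers (`core_card_le_of_runs`, `mixed_at_cut_le_of_runs` below): the partition branch of the
half-type floors sees only multi-ruler runs. -/
theorem sameRun_of_sameClass (S : CycleSystem q t) (hq : 1 ≤ q) (hN : S.Normal)
    {B R : Finset (Fin (3 * q + 1))} {c₀ : Fin (3 * q + 1) → Fin 3} (h : CoreRigidInside B R S.edges c₀)
    (hB : ∃ z, z ∉ B) {u w : Fin (3 * q + 1)} (hu : u ∈ R) (hw : w ∈ R) (huB : u ∈ B) (hwB : w ∈ B)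
    (huw : u ≠ w) (hc : c₀ u = c₀ w) (k : Fin t) : S.SameRun k B u w := by
  by_contra hrun
  by_cases hd : (S.pos k u - S.pos k w).val % 3 = 2
  · exact h.ne_of_separable hu hw (separable_of_exit S hq hN k hwB hB hd) hc
  · obtain ⟨hs, hm⟩ := flexible_of_not_sameRun S hq hN k huB hwB huw hB hrun hd
    exact h.not_both hu hw hs hm

/-- … and two vertices of a forced core NOT in a common run of some ruler lie in different classes, at ruler
distance `≡ 2 (mod 3)` along every ruler in which they are not in a common run. -/
theorem two_of_not_sameRun (S : CycleSystem q t) (hq : 1 ≤ q) (hN : S.Normal)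
    {B R : Finset (Fin (3 * q + 1))} {c₀ : Fin (3 * q + 1) → Fin 3} (h : CoreRigidInside B R S.edges c₀)
    (hB : ∃ z, z ∉ B) {u w : Fin (3 * q + 1)} (hu : u ∈ R) (hw : w ∈ R) (huB : u ∈ B) (hwB : w ∈ B)
    (huw : u ≠ w) (k : Fin t) (hrun : ¬ S.SameRun k B u w) :
    c₀ u ≠ c₀ w ∧ (S.pos k u - S.pos k w).val % 3 = 2 := by
  refine ⟨fun hc => hrun (sameRun_of_sameClass S hq hN h hB hu hw huB hwB huw hc k), ?_⟩
  by_contra hd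
  obtain ⟨hs, hm⟩ := flexible_of_not_sameRun S hq hN k huB hwB huw hB hrun hd
  exact h.not_both hu hw hs hm

/-! #### The run bound: `|R ∩ B| ≤ 3ρ(B)` and `e(S[B]) ≤ |β| + 3tρ(B)` -/

/-- `CommonRunBound S B ρ`: every subset of `B` whose elements are pairwise in a common run of EVERY ruler inside `B`
has at most `ρ` elements (`ρ(B)` of the memo is the least such `ρ`). -/
def CycleSystem.CommonRunBound (S : CycleSystem q t) (B : Finset (Fin (3 * q + 1))) (ρ : ℕ) : Prop :=
  ∀ X ⊆ B, (∀ u ∈ X, ∀ w ∈ X, u ≠ w → ∀ k : Fin t, S.SameRun k B u w) → X.card ≤ ρ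

/-- **RUN BOUND ON FORCED CORES.**  For a normal system, a cut `B ≠ V` with common-run bound `ρ`, and any forced core
`(R, c₀)` over `B`: `|R ∩ B| ≤ 3ρ` (each of the `≤ 3` colour classes of `c₀` on `R ∩ B` is a common run of all rulers,
by `sameRun_of_sameClass`). -/
theorem core_card_le_of_runs (S : CycleSystem q t) (hq : 1 ≤ q) (hN : S.Normal)
    {B R : Finset (Fin (3 * q + 1))} {c₀ : Fin (3 * q + 1) → Fin 3} (h : CoreRigidInside B R S.edges c₀)
    (hB : ∃ z, z ∉ B) {ρ : ℕ} (hρ : S.CommonRunBound B ρ) : (R ∩ B).card ≤ 3 * ρ := by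
  classical
  have hfib : ∀ a : Fin 3, ((R ∩ B).filter (fun v => c₀ v = a)).card ≤ ρ := by
    intro a
    refine hρ _ (fun v hv => (Finset.mem_inter.1 (Finset.mem_filter.1 hv).1).2) ?_
    intro u hu w hw huw k
    obtain ⟨hu', hua⟩ := Finset.mem_filter.1 hu
    obtain ⟨hw', hwa⟩ := Finset.mem_filter.1 hw
    obtain ⟨huR, huB⟩ := Finset.mem_inter.1 hu'
    obtain ⟨hwR, hwB⟩ := Finset.mem_inter.1 hw'
    exact sameRun_of_sameClass S hq hN h hB huR hwR huB hwB huw (hua.trans hwa.symm) k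
  have hcover : R ∩ B ⊆ (Finset.univ : Finset (Fin 3)).biUnion (fun a => (R ∩ B).filter (fun v => c₀ v = a)) := by
    intro v hv
    exact Finset.mem_biUnion.2 ⟨c₀ v, Finset.mem_univ _, Finset.mem_filter.2 ⟨hv, rfl⟩⟩
  calc (R ∩ B).card
      ≤ ((Finset.univ : Finset (Fin 3)).biUnion (fun a => (R ∩ B).filter (fun v => c₀ v = a))).card :=
        Finset.card_le_card hcover
    _ ≤ ∑ a : Fin 3, ((R ∩ B).filter (fun v => c₀ v = a)).card := Finset.card_biUnion_le
    _ ≤ ∑ _a : Fin 3, ρ := Finset.sum_le_sum (fun a _ => hfib a)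
    _ = 3 * ρ := by simp [mul_comm]

/-- **THE PARTITION BRANCH AT A CUT, RUN FORM.**  For a normal system, a cut `B ≠ V` with common-run bound `ρ`, any
forced core `(R, c₀)` and any sandwich `S[B] ⊆ S[R] ∪ β`: `e(S[B]) ≤ |β| + 3tρ`.  I.e. the partition part of the
mixed / master floors of `HalfTypeFloor.lean` certifies at most `3tρ(B)` edges of a normal system's half, at every
cut; the rest must be sparse or listed. -/
theorem mixed_at_cut_le_of_runs (S : CycleSystem q t) (hq : 1 ≤ q) (hN : S.Normal)
    {B R : Finset (Fin (3 * q + 1))} {c₀ : Fin (3 * q + 1) → Fin 3} {β : Finset (Sym2 (Fin (3 * q + 1)))}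
    (h : CoreRigidInside B R S.edges c₀) (hB : ∃ z, z ∉ B) {ρ : ℕ} (hρ : S.CommonRunBound B ρ)
    (hcov : bobSide B S.edges ⊆ bobSide R S.edges ∪ β) :
    (bobSide B S.edges).card ≤ β.card + 3 * t * ρ := by
  have h1 := core_card_le_of_runs S hq hN h hB hρ
  have h2 := card_bobSide_le S (R ∩ B)
  calc (bobSide B S.edges).card ≤ (bobSide (R ∩ B) S.edges ∪ β).card :=
        Finset.card_le_card (sandwich_inter hcov)
    _ ≤ (bobSide (R ∩ B) S.edges).card + β.card := Finset.card_union_le _ _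
    _ ≤ t * (R ∩ B).card + β.card := by omega
    _ ≤ t * (3 * ρ) + β.card := by gcongr
    _ = β.card + 3 * t * ρ := by ring


/-! ### §4 (g16, line B) ONE-SIDED VERTICES — Alice's extension sets contain subcubes

Reply to `IDEATION-CENSUS-r2s1g23.md` BN-g23-8 (the "parity tax": the kill side was asked to test run-length-2
classes on the normal instances).  Every separator on colouring space — parity, the exact mod-3 PHASE of memo §10.4,
a random hash — needs Alice's extension set `EXT_B(S_A)|_B` (the `B`-restrictions of the proper 3-colourings of
Alice's side) to be essentially the set of internal seam words.  It never is: `B` is INDEPENDENT in Alice's side,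
so any set `W ⊆ B` of vertices each seeing a single colour on its neighbours outside `B` recolours in all `2^|W|`
ways (`recolour_aliceProper`, `recolour_injOn`, `card_recolour_family`); and under the internal seam `(k, x)` of a
normal system every `v ∈ B` with `succ_k v ∈ B` that PRECEDES all its outside neighbours along ruler `k` (seen from
`succ_k x`) is such a vertex, new colour `c v + 1` (`seamColour_after`, `seamColour_pred_of_ne`, `oneSided_family`)
— in particular `succ_k x` itself whenever it is a `k`-middle (`middle_oneSided`).  So exact Alice-rigidity fails at
every cut containing a ruler run of length `≥ 3`; at random balanced cuts of `C₂₈₉`, `C₁₀₀₉` a quarter of `B` is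
one-sided under EVERY internal seam (memo §10, D: `|W| ≥ 65` always at `n = 1009`), i.e. `|EXT_B(S_A)|_B| ≥ 2^65`.
-/

section OneSided

variable {n : ℕ}

/-- recolour the vertices of `W` by `s`, keep `c` elsewhere. -/
def recolour (c : Fin n → Fin 3) (W : Finset (Fin n)) (s : Fin n → Fin 3) : Fin n → Fin 3 :=
  fun v => if v ∈ W then s v else c v

theorem recolour_of_mem {c s : Fin n → Fin 3} {W : Finset (Fin n)} {v : Fin n} (hv : v ∈ W) :
    recolour c W s v = s v := by simp [recolour, hv]

theorem recolour_of_not_mem {c s : Fin n → Fin 3} {W : Finset (Fin n)} {v : Fin n} (hv : v ∉ W) :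
    recolour c W s v = c v := by simp [recolour, hv]

/-- **`B` is independent in Alice's side, so one-sided vertices recolour freely.**  If `c` is proper on Alice's
side, `W ⊆ B`, and the new colour `s w` of each `w ∈ W` avoids the colours of `w`'s neighbours OUTSIDE `B`, then
the recoloured colouring is proper on Alice's side (edges inside `B` are Bob's; there is nothing else to check). -/
theorem recolour_aliceProper {B W : Finset (Fin n)} {F : Finset (Sym2 (Fin n))} {c s : Fin n → Fin 3}
    (hWB : W ⊆ B) (hc : c ∉ killSet (aliceSide B F))
    (hs : ∀ w ∈ W, ∀ u : Fin n, s(w, u) ∈ F → u ∉ B → s w ≠ c u) :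
    recolour c W s ∉ killSet (aliceSide B F) := by
  rintro ⟨e, he, hnd, hm⟩
  obtain ⟨heF, hex⟩ := mem_aliceSide.1 he
  induction e using Sym2.ind with
  | h a b =>
    rw [map_mk_isDiag_iff] at hm
    obtain ⟨v, hv, hvB⟩ := hex
    rw [Sym2.mem_iff] at hv
    by_cases ha : a ∈ W
    · have hbB : b ∉ B := by
        rcases hv with rfl | rfl
        · exact absurd (hWB ha) hvB
        · exact hvB
      have hb : b ∉ W := fun h => hbB (hWB h)
      rw [recolour_of_mem ha, recolour_of_not_mem hb] at hm
      exact hs a ha b heF hbB hm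
    · by_cases hb : b ∈ W
      · have haB : a ∉ B := by
          rcases hv with rfl | rfl
          · exact hvB
          · exact absurd (hWB hb) hvB
        rw [recolour_of_not_mem ha, recolour_of_mem hb] at hm
        have heF' : s(b, a) ∈ F := by rw [Sym2.eq_swap]; exact heF
        exact hs b hb a heF' haB hm.symm
      · rw [recolour_of_not_mem ha, recolour_of_not_mem hb] at hm
        exact hc ⟨s(a, b), he, hnd, (map_mk_isDiag_iff c a b).2 hm⟩

/-- distinct subsets of `W` give recolourings that differ on `B` (indeed on `W`), provided `s` changes colours. -/
theorem recolour_injOn {B W W₁ W₂ : Finset (Fin n)} {c s : Fin n → Fin 3} (hWB : W ⊆ B)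
    (hsc : ∀ w ∈ W, s w ≠ c w) (h₁ : W₁ ⊆ W) (h₂ : W₂ ⊆ W)
    (heq : ∀ v ∈ B, recolour c W₁ s v = recolour c W₂ s v) : W₁ = W₂ := by
  ext w
  constructor
  · intro hw
    by_contra hw2
    have h := heq w (hWB (h₁ hw))
    rw [recolour_of_mem hw, recolour_of_not_mem hw2] at h
    exact hsc w (h₁ hw) h
  · intro hw
    by_contra hw1
    have h := heq w (hWB (h₂ hw))
    rw [recolour_of_not_mem hw1, recolour_of_mem hw] at h
    exact hsc w (h₂ hw) h.symm

/-- **THE SUBCUBE.**  `2^|W|` colourings, all proper on Alice's side, pairwise distinct (even on `B`, by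
`recolour_injOn`): `|EXT_B(F_A)|_B| ≥ 2^|W|` for every one-sided set `W`. -/
theorem card_recolour_family {B W : Finset (Fin n)} {F : Finset (Sym2 (Fin n))} {c s : Fin n → Fin 3}
    (hWB : W ⊆ B) (hc : c ∉ killSet (aliceSide B F))
    (hs : ∀ w ∈ W, ∀ u : Fin n, s(w, u) ∈ F → u ∉ B → s w ≠ c u) (hsc : ∀ w ∈ W, s w ≠ c w) :
    (∀ W' ∈ W.powerset, recolour c W' s ∉ killSet (aliceSide B F)) ∧
      (W.powerset.image fun W' => recolour c W' s).card = 2 ^ W.card := by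
  refine ⟨fun W' hW' => recolour_aliceProper ((Finset.mem_powerset.1 hW').trans hWB) hc
    (fun w hw u huF huB => hs w (Finset.mem_powerset.1 hW' hw) u huF huB), ?_⟩
  rw [Finset.card_image_of_injOn, Finset.card_powerset]
  intro W₁ h₁ W₂ h₂ heq
  exact recolour_injOn hWB hsc (Finset.mem_powerset.1 (Finset.mem_coe.1 h₁))
    (Finset.mem_powerset.1 (Finset.mem_coe.1 h₂)) (fun v _ => congrFun heq v)

end OneSided

theorem fin3_add_one_ne (a : Fin 3) : a + 1 ≠ a := by revert a; decide

theorem fin3_add_one_ne_add_two (a : Fin 3) : a + 1 ≠ a + 2 := by revert a; decide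

theorem seamColour_val (S : CycleSystem q t) (k : Fin t) (x y : Fin (3 * q + 1)) :
    (seamColour S k x y).val = (S.pos k y - S.pos k x - 1).val % 3 := rfl

/-- NORMALITY BACKWARDS: the ruler-`j` predecessor is also at ruler-`k` distance `≡ 2 (mod 3)` (`n ≡ 1`). -/
theorem normal_pred_val (S : CycleSystem q t) (hN : S.Normal) {k j : Fin t} (hkj : k ≠ j)
    (v : Fin (3 * q + 1)) : (S.pos k (S.pred j v) - S.pos k v).val % 3 = 2 := by
  have h := hN k j hkj (S.pred j v)
  rw [S.succ_pred] at h
  set E := S.pos k v - S.pos k (S.pred j v) with hE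
  have hneg : S.pos k (S.pred j v) - S.pos k v = -E := by rw [hE]; ring
  have hElt := E.isLt
  have hEpos : 0 < E.val := by
    rcases Nat.eq_zero_or_pos E.val with h0 | h0
    · rw [h0] at h; omega
    · exact h0
  have hv : (-E).val = 3 * q + 1 - E.val := by
    rw [Fin.val_neg', Nat.mod_eq_of_lt (by omega)]
  rw [hneg, hv]
  omega

/-- **RELATIVE COLOURS UNDER A SEAM — the before/after law (after).**  Under the seam of ruler `k` at `x`, a vertex
`u` at ruler-`k` distance `≡ 2 (mod 3)` from `v` that comes AFTER `v` (walking from `succ_k x` one meets `v` no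
later than `u`, no wrap) has colour `c v + 2`. -/
theorem seamColour_after (S : CycleSystem q t) (k : Fin t) {x v u : Fin (3 * q + 1)}
    (hd : (S.pos k u - S.pos k v).val % 3 = 2)
    (hafter : (S.pos k v - S.pos k x - 1).val + (S.pos k u - S.pos k v).val < 3 * q + 1) :
    seamColour S k x u = seamColour S k x v + 2 := by
  apply Fin.ext
  have h2 : (2 : Fin 3).val = 2 := rfl
  rw [Fin.val_add, seamColour_val, seamColour_val, h2]
  have hB : S.pos k u - S.pos k x - 1 = (S.pos k v - S.pos k x - 1) + (S.pos k u - S.pos k v) := by ring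
  rw [hB, Fin.val_add, Nat.mod_eq_of_lt hafter]
  omega

/-- (before).  If instead `u` comes BEFORE `v` (the walk from `succ_k x` wraps), `u` has colour `c v + 1`. -/
theorem seamColour_before (S : CycleSystem q t) (k : Fin t) {x v u : Fin (3 * q + 1)}
    (hd : (S.pos k u - S.pos k v).val % 3 = 2)
    (hbefore : 3 * q + 1 ≤ (S.pos k v - S.pos k x - 1).val + (S.pos k u - S.pos k v).val) :
    seamColour S k x u = seamColour S k x v + 1 := by
  apply Fin.ext
  have h1 : (1 : Fin 3).val = 1 := rfl
  rw [Fin.val_add, seamColour_val, seamColour_val, h1]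
  have hB : S.pos k u - S.pos k x - 1 = (S.pos k v - S.pos k x - 1) + (S.pos k u - S.pos k v) := by ring
  have hAlt := (S.pos k v - S.pos k x - 1).isLt
  have hDlt := (S.pos k u - S.pos k v).isLt
  have hmod : ((S.pos k v - S.pos k x - 1).val + (S.pos k u - S.pos k v).val) % (3 * q + 1) =
      (S.pos k v - S.pos k x - 1).val + (S.pos k u - S.pos k v).val - (3 * q + 1) := by
    rw [Nat.mod_eq_sub_mod hbefore]
    exact Nat.mod_eq_of_lt (by omega)
  rw [hB, Fin.val_add, hmod]
  omega

/-- the backward `k`-neighbour of `v ≠ succ_k x` has colour `c v + 2` under the seam at `x`. -/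
theorem seamColour_pred_of_ne (S : CycleSystem q t) (hq : 1 ≤ q) (k : Fin t) {x v : Fin (3 * q + 1)}
    (hv : v ≠ S.succ k x) : seamColour S k x (S.pred k v) = seamColour S k x v + 2 := by
  apply Fin.ext
  have h2 : (2 : Fin 3).val = 2 := rfl
  rw [Fin.val_add, seamColour_val, seamColour_val, h2]
  set A := S.pos k v - S.pos k x - 1 with hA
  have hB : S.pos k (S.pred k v) - S.pos k x - 1 = A - 1 := by rw [S.pos_pred, hA]; ring
  have h1v : (1 : Fin (3 * q + 1)).val = 1 := by
    rw [Fin.val_one']; exact Nat.mod_eq_of_lt (by omega)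
  have hA0 : A ≠ 0 := by
    intro h0
    apply hv
    apply (S.pos k).injective
    rw [S.pos_succ]
    have : S.pos k v - S.pos k x - 1 = 0 := by rw [← hA]; exact h0
    linear_combination this
  have hA1 : 1 ≤ A.val := by
    rcases Nat.eq_zero_or_pos A.val with h0 | h0
    · exact absurd (Fin.ext (by rw [h0]; rfl)) hA0
    · exact h0
  have hsub : (A - 1).val = A.val - 1 := by
    rw [Fin.coe_sub_iff_le.2 (by rw [Fin.le_def, h1v]; exact hA1), h1v]
  rw [hB, hsub]
  omega

/-- an INTERNAL seam (`x, succ_k x ∈ B`) is proper on Alice's side. -/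
theorem seam_aliceProper (S : CycleSystem q t) (hq : 1 ≤ q) (hN : S.Normal) (k : Fin t)
    {B : Finset (Fin (3 * q + 1))} {x : Fin (3 * q + 1)} (hx : x ∈ B ∧ S.succ k x ∈ B) :
    seamColour S k x ∉ killSet (aliceSide B S.edges) := by
  intro h
  refine seam_not_mem_killSet_erase S hq hN k x (killSet_mono (fun e he => ?_) h)
  obtain ⟨heE, w, hw, hwB⟩ := mem_aliceSide.1 he
  refine Finset.mem_erase.2 ⟨?_, heE⟩
  rintro rfl
  rw [Sym2.mem_iff] at hw
  rcases hw with rfl | rfl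
  · exact hwB hx.1
  · exact hwB hx.2

/-- `v ∈ B` is ONE-SIDED (after-type) at the seam `(k, x)` w.r.t. the cut `B`: its forward `k`-neighbour lies in `B`,
and every other-ruler neighbour outside `B` comes after `v` along ruler `k`, seen from `succ_k x`. -/
def OneSidedAfter (S : CycleSystem q t) (k : Fin t) (B : Finset (Fin (3 * q + 1))) (x v : Fin (3 * q + 1)) :
    Prop :=
  v ∈ B ∧ S.succ k v ∈ B ∧ ∀ j : Fin t, j ≠ k → ∀ u ∈ ({S.succ j v, S.pred j v} : Finset (Fin (3 * q + 1))),
    u ∉ B → (S.pos k v - S.pos k x - 1).val + (S.pos k u - S.pos k v).val < 3 * q + 1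

/-- **ONE-SIDED VERTICES RECOLOUR UNDER THE SEAM.**  For a normal system, an INTERNAL seam `(k, x)`
(`x, succ_k x ∈ B`) and any set `W` of one-sided vertices, the `2^|W|` recolourings of the seam colouring (`+1` on
an arbitrary `W' ⊆ W`) are all proper on Alice's side and pairwise distinct: Alice's extension set at `B` contains
a `|W|`-dimensional subcube around every internal seam word. -/
theorem oneSided_family (S : CycleSystem q t) (hq : 1 ≤ q) (hN : S.Normal) (k : Fin t)
    {B W : Finset (Fin (3 * q + 1))} {x : Fin (3 * q + 1)} (hx : x ∈ B ∧ S.succ k x ∈ B)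
    (hW : ∀ v ∈ W, OneSidedAfter S k B x v) :
    (∀ W' ∈ W.powerset,
        recolour (seamColour S k x) W' (fun v => seamColour S k x v + 1) ∉ killSet (aliceSide B S.edges)) ∧
      (W.powerset.image fun W' => recolour (seamColour S k x) W' (fun v => seamColour S k x v + 1)).card
        = 2 ^ W.card := by
  have hWB : W ⊆ B := fun v hv => (hW v hv).1
  refine card_recolour_family hWB (seam_aliceProper S hq hN k hx) ?_ (fun w _ => fin3_add_one_ne _)
  · intro w hw u huE huB
    obtain ⟨-, hsw, hafter⟩ := hW w hw
    obtain ⟨⟨j, z⟩, -, hz⟩ := Finset.mem_image.mp huE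
    have hz' : s(z, S.succ j z) = s(w, u) := hz
    rw [Sym2.eq_iff] at hz'
    show seamColour S k x w + 1 ≠ seamColour S k x u
    rcases hz' with ⟨hzw, hzu⟩ | ⟨hzu, hzw⟩
    · -- `u = succ_j w`
      have hu : u = S.succ j w := by rw [← hzu, hzw]
      rw [hu] at huB ⊢
      by_cases hjk : j = k
      · rw [hjk] at huB; exact absurd hsw huB
      · have hd : (S.pos k (S.succ j w) - S.pos k w).val % 3 = 2 := hN k j (Ne.symm hjk) w
        have haft := hafter j hjk (S.succ j w) (by simp) huB
        rw [seamColour_after S k hd haft]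
        exact fin3_add_one_ne_add_two _
    · -- `u = pred_j w`
      have hu : u = S.pred j w := by rw [← hzu, ← hzw, S.pred_succ]
      rw [hu] at huB ⊢
      by_cases hjk : j = k
      · rw [hjk] at huB ⊢
        have hne : w ≠ S.succ k x := by
          rintro rfl
          rw [S.pred_succ] at huB
          exact huB hx.1
        rw [seamColour_pred_of_ne S hq k hne]
        exact fin3_add_one_ne_add_two _
      · have hd : (S.pos k (S.pred j w) - S.pos k w).val % 3 = 2 := normal_pred_val S hN (Ne.symm hjk) w
        have haft := hafter j hjk (S.pred j w) (by simp) huB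
        rw [seamColour_after S k hd haft]
        exact fin3_add_one_ne_add_two _

/-- The vertex right after an internal seam is one-sided as soon as it is a `k`-MIDDLE (`succ_k (succ_k x) ∈ B`): so
Alice-rigidity "`EXT_B(S_A)|_B` = internal seam words" fails at EVERY cut containing a ruler run of length `≥ 3`
(combine with `oneSided_family`, `W = {succ_k x}`). -/
theorem middle_oneSided (S : CycleSystem q t) (k : Fin t) {B : Finset (Fin (3 * q + 1))} {x : Fin (3 * q + 1)}
    (h1 : S.succ k x ∈ B) (h2 : S.succ k (S.succ k x) ∈ B) : OneSidedAfter S k B x (S.succ k x) := by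
  refine ⟨h1, h2, fun j _ u _ _ => ?_⟩
  have hA : S.pos k (S.succ k x) - S.pos k x - 1 = 0 := by rw [S.pos_succ]; ring
  rw [hA, Fin.val_zero, zero_add]
  exact Fin.isLt _


/-! ### §5 (g16, line B) CONJUGATE HYBRIDS ARE LIGHT — relabelling-closed classes are never light-free

If `c` is proper on Alice's side of `F` over `B`, `c'` is proper on Bob's half `F[B]`, and a relabelling `π` of the
vertices makes `c ∘ π` agree with `σ ∘ c'` on `B` for a permutation `σ` of the colours, then `c` properly colours the
HYBRID `F_A ∪ π(F[B])` (`conjugate_hybrid_proper`, `conjugate_hybrid_colorable`).  For a normal system take `c` an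
internal seam word (Alice-proper, `seam_aliceProper`) and `c'` an external one (Bob-proper, `seam_bobProper`):
whenever they have the same multiset of colour-class sizes on `B`, a `π` supported on `B` matching the classes
exists, and the hybrid of the member with its own relabelling `π̂(S)` is LIGHT (`seam_conjugate_hybrid_colorable`)
— so no relabelling-closed class of members is light-free (memo §10.5, against BN-g23-8's prediction). -/

section Conjugate

variable {n : ℕ}

/-- **Conjugate hybrids are light** (two species allowed: Alice's side of `F`, Bob's half of `F'`). -/
theorem conjugate_hybrid_proper {B : Finset (Fin n)} {F F' : Finset (Sym2 (Fin n))} {c c' : Fin n → Fin 3}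
    (π : Equiv.Perm (Fin n)) (σ : Equiv.Perm (Fin 3))
    (hc : c ∉ killSet (aliceSide B F)) (hc' : c' ∉ killSet (bobSide B F'))
    (hπ : ∀ v ∈ B, c (π v) = σ (c' v)) :
    c ∉ killSet (aliceSide B F ∪ (bobSide B F').image (Sym2.map π)) := by
  classical
  intro h
  rcases mem_killSet_union h with hA | hB
  · exact hc hA
  · obtain ⟨e, he, hnd, hm⟩ := hB
    obtain ⟨f, hf, rfl⟩ := Finset.mem_image.1 he
    obtain ⟨-, hfB⟩ := mem_bobSide.1 hf
    apply hc'
    refine ⟨f, hf, fun hfd => hnd ((Sym2.isDiag_map π.injective).2 hfd), ?_⟩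
    induction f using Sym2.ind with
    | h a b =>
      rw [map_mk_isDiag_iff]
      have ha : a ∈ B := hfB a (Sym2.mem_mk_left a b)
      have hb : b ∈ B := hfB b (Sym2.mem_mk_right a b)
      have hm' : c (π a) = c (π b) := by
        rw [Sym2.map_mk, map_mk_isDiag_iff] at hm
        exact hm
      rw [hπ a ha, hπ b hb] at hm'
      exact σ.injective hm'

/-- … hence the hybrid `F_A ∪ π(F'[B])` is 3-colourable. -/
theorem conjugate_hybrid_colorable {B : Finset (Fin n)} {F F' : Finset (Sym2 (Fin n))} {c c' : Fin n → Fin 3}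
    (π : Equiv.Perm (Fin n)) (σ : Equiv.Perm (Fin 3))
    (hc : c ∉ killSet (aliceSide B F)) (hc' : c' ∉ killSet (bobSide B F'))
    (hπ : ∀ v ∈ B, c (π v) = σ (c' v)) :
    Col3 (aliceSide B F ∪ (bobSide B F').image (Sym2.map π)) :=
  (colorable_iff_exists_not_mem_killSet _).2 ⟨c, conjugate_hybrid_proper π σ hc hc' hπ⟩

/-- the unrelabelled case (`π = id`): a colouring proper on Alice's side of `F` that agrees on `B`, up to a
permutation of the colours, with one proper on Bob's half of `F'` makes the CROSS HYBRID `F_A ∪ F'[B]` light. -/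
theorem cross_hybrid_colorable {B : Finset (Fin n)} {F F' : Finset (Sym2 (Fin n))} {c c' : Fin n → Fin 3}
    (σ : Equiv.Perm (Fin 3))
    (hc : c ∉ killSet (aliceSide B F)) (hc' : c' ∉ killSet (bobSide B F'))
    (hσ : ∀ v ∈ B, c v = σ (c' v)) :
    Col3 (aliceSide B F ∪ bobSide B F') := by
  classical
  have h := conjugate_hybrid_colorable (Equiv.refl (Fin n)) σ hc hc' (fun v hv => by simpa using hσ v hv)
  have himg : (bobSide B F').image (Sym2.map ⇑(Equiv.refl (Fin n))) = bobSide B F' := by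
    rw [Equiv.coe_refl, Sym2.map_id, Finset.image_id]
  rw [himg] at h
  exact h

end Conjugate

/-- **Cycle systems: a member glued to its class-size-matched relabelling is light.**  Internal seam word `c_{k,x}`
(`x, succ_k x ∈ B`), external seam word `c_{k',x'}` (seam edge not inside `B`), `π` a relabelling with
`c_{k,x} ∘ π = σ ∘ c_{k',x'}` on `B`: the hybrid `S_A ∪ π(S[B])` is 3-colourable. -/
theorem seam_conjugate_hybrid_colorable (S : CycleSystem q t) (hq : 1 ≤ q) (hN : S.Normal)
    {B : Finset (Fin (3 * q + 1))} {k k' : Fin t} {x x' : Fin (3 * q + 1)}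
    (hx : x ∈ B ∧ S.succ k x ∈ B) (hx' : ¬ (x' ∈ B ∧ S.succ k' x' ∈ B))
    (π : Equiv.Perm (Fin (3 * q + 1))) (σ : Equiv.Perm (Fin 3))
    (hπ : ∀ v ∈ B, seamColour S k x (π v) = σ (seamColour S k' x' v)) :
    Col3 (aliceSide B S.edges ∪ (bobSide B S.edges).image (Sym2.map π)) :=
  conjugate_hybrid_colorable π σ (seam_aliceProper S hq hN k hx) (seam_bobProper S hq hN k' x' hx') hπ

/-- **Shared words make cross hybrids light** (memo §10.7, the kernel of «inside a word class, cross-dark ⇒ same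
Bob half»): two normal systems `S, S'` on the same vertex set, an INTERNAL seam word of `S` at `B` that coincides
on `B`, up to a permutation of the colours, with an EXTERNAL seam word of `S'` ⇒ the cross hybrid `S_A ∪ S'[B]` is
3-colourable.  (Members with the same place data at `B` have the same words place by place; where their gaps differ
— gap `0` in `S`, gap `> 0` in `S'` — the shared word is internal for `S` and external for `S'`.) -/
theorem cross_hybrid_colorable_of_shared_word (S S' : CycleSystem q t) (hq : 1 ≤ q)
    (hN : S.Normal) (hN' : S'.Normal)
    {B : Finset (Fin (3 * q + 1))} {k k' : Fin t} {x x' : Fin (3 * q + 1)}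
    (hx : x ∈ B ∧ S.succ k x ∈ B) (hx' : ¬ (x' ∈ B ∧ S'.succ k' x' ∈ B))
    (σ : Equiv.Perm (Fin 3)) (hσ : ∀ v ∈ B, seamColour S k x v = σ (seamColour S' k' x' v)) :
    Col3 (aliceSide B S.edges ∪ bobSide B S'.edges) :=
  cross_hybrid_colorable σ (seam_aliceProper S hq hN k hx) (seam_bobProper S' hq hN' k' x' hx') hσ


/-! ### §6 (g16, line B) THE PHASE INCREMENT LAW (memo §10.4)

`phase B c = Σ_{w ∈ B} c w ∈ Fin 3`.  Advancing the seam of ruler `k` by one vertex subtracts `1` from every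
colour and gives it back at the vertex just passed (`seamColour_succ_add_one`); hence, when `3 ∣ |B|`, the phase
of the `B`-word grows by `[succ_k x ∈ B]` (`phase_seam_succ`).  On a cut made of separated ruler-`k` TRIPLES the
phase therefore separates internal from external seam WORDS exactly and template-free — and the separator is void
as a rectangle because the one-sided corrections of §4 move the phase (memo §10.4). -/

/-- the mod-3 phase of a colouring on `B`. -/
def phase {n : ℕ} (B : Finset (Fin n)) (c : Fin n → Fin 3) : Fin 3 := ∑ w ∈ B, c w

/-- pointwise seam-advance identity: `c_{k, succ x}(v) + 1 = c_{k,x}(v) + [v = succ x]`. -/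
theorem seamColour_succ_add_one (S : CycleSystem q t) (hq : 1 ≤ q) (k : Fin t) (x v : Fin (3 * q + 1)) :
    seamColour S k (S.succ k x) v + 1 = seamColour S k x v + (if v = S.succ k x then 1 else 0) := by
  have h1v : (1 : Fin (3 * q + 1)).val = 1 := by
    rw [Fin.val_one']; exact Nat.mod_eq_of_lt (by omega)
  have h13 : (1 : Fin 3).val = 1 := rfl
  have hD : S.pos k v - S.pos k (S.succ k x) - 1 = (S.pos k v - S.pos k x - 1) - 1 := by
    rw [S.pos_succ]; ring
  apply Fin.ext
  rw [Fin.val_add, seamColour_val, hD, h13]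
  by_cases hv : v = S.succ k x
  · subst hv
    rw [if_pos rfl, Fin.val_add, seamColour_val, h13, S.pos_succ]
    have h0 : S.pos k x + 1 - S.pos k x - 1 = (0 : Fin (3 * q + 1)) := by ring
    rw [h0, zero_sub, Fin.coe_neg_one, Fin.val_zero]
    omega
  · rw [if_neg hv, add_zero, seamColour_val]
    have hDne : S.pos k v - S.pos k x - 1 ≠ 0 := by
      intro h
      apply hv
      have h' : S.pos k v = S.pos k x + 1 := by
        have : S.pos k v - (S.pos k x + 1) = 0 := by rw [← h]; ring
        exact sub_eq_zero.1 this
      rw [← S.pos_succ] at h'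
      exact (S.pos k).injective h'
    have hpos : 1 ≤ (S.pos k v - S.pos k x - 1).val := by
      rcases Nat.eq_zero_or_pos (S.pos k v - S.pos k x - 1).val with h | h
      · exact absurd (Fin.ext (by rw [h, Fin.val_zero])) hDne
      · exact h
    rw [Fin.coe_sub_iff_le.2 (by
      change (1 : Fin (3 * q + 1)).val ≤ (S.pos k v - S.pos k x - 1).val
      rw [h1v]; exact hpos), h1v]
    omega

/-- **Phase increment law.**  `3 ∣ |B|` ⇒ `phase B c_{k, succ x} = phase B c_{k,x} + [succ_k x ∈ B]`. -/
theorem phase_seam_succ (S : CycleSystem q t) (hq : 1 ≤ q) (k : Fin t) (x : Fin (3 * q + 1))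
    {B : Finset (Fin (3 * q + 1))} (hB : 3 ∣ B.card) :
    phase B (seamColour S k (S.succ k x)) =
      phase B (seamColour S k x) + (if S.succ k x ∈ B then 1 else 0) := by
  classical
  unfold phase
  have h := Finset.sum_congr rfl (fun w (_ : w ∈ B) => seamColour_succ_add_one S hq k x w)
  rw [Finset.sum_add_distrib, Finset.sum_add_distrib, Finset.sum_const, Finset.sum_ite_eq'] at h
  have hc : B.card • (1 : Fin 3) = 0 := by
    obtain ⟨m, hm⟩ := hB
    rw [hm, mul_nsmul]
    have h3 : 3 • (1 : Fin 3) = 0 := by decide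
    rw [h3, nsmul_zero]
  rw [hc, add_zero] at h
  exact h

/-- TRIPLE CUTS: if `succ x, succ² x, succ³ x ∈ B` (a ruler-`k` triple entered by the seam at `x`), the two
internal seams of the triple (at `succ x`, `succ² x`) and the seam leaving it (at `succ³ x`) have phases
`φ + 1, φ + 2, φ + 3 = φ`, where `φ` is the phase of the entering seam — so, iterating along a ruler made of
separated triples, all external seams share one phase and the internal ones carry the two others (memo §10.4).
Stated for one triple. -/
theorem phase_triple (S : CycleSystem q t) (hq : 1 ≤ q) (k : Fin t) (x : Fin (3 * q + 1))
    {B : Finset (Fin (3 * q + 1))} (hB : 3 ∣ B.card)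
    (h1 : S.succ k x ∈ B) (h2 : S.succ k (S.succ k x) ∈ B) (h3 : S.succ k (S.succ k (S.succ k x)) ∈ B) :
    phase B (seamColour S k (S.succ k x)) = phase B (seamColour S k x) + 1 ∧
    phase B (seamColour S k (S.succ k (S.succ k x))) = phase B (seamColour S k x) + 2 ∧
    phase B (seamColour S k (S.succ k (S.succ k (S.succ k x)))) = phase B (seamColour S k x) := by
  have e1 := phase_seam_succ S hq k x hB
  have e2 := phase_seam_succ S hq k (S.succ k x) hB
  have e3 := phase_seam_succ S hq k (S.succ k (S.succ k x)) hB
  rw [if_pos h1] at e1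
  rw [if_pos h2] at e2
  rw [if_pos h3] at e3
  refine ⟨e1, ?_, ?_⟩
  · rw [e2, e1]; ring
  · rw [e3, e2, e1, add_assoc, add_assoc, show (1 : Fin 3) + (1 + 1) = 0 by decide, add_zero]

end Summit.PneNP.PneNP.Cruxes.FoolingMeasure.P4g16
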